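/-
  Summits/AtomisticToContinuum/Crystallization/Theorems/OverbindingBudgetAffineFarBaseChart.lean

  residual stmt-AtomisticToContinuum-31280 · slot Z `FarAggregatePricing 12 (1/25) (1/2000) (1/(2·10⁷))` · leaf Zr‴a′
  `ShelteredFarCharting' (1/25) (1/2000)` (leaf list v14′; critic rows 949/953): Zr‴a′ part 1 — THE BASE CHART of an engine frame.
  decomp-a2c lens-4, generation 59.  Imports E4 part 4 `…FarEngineLabels`.  0 sorry · 0 axiom · no instance · no notation · no option.
-/
import Summits.AtomisticToContinuum.Crystallization.Theorems.OverbindingBudgetAffineFarEngineLabels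

/-! # Zr‴a′ part 1 — the BASE CHART of a based engine frame (PROVED)

Setting: an engine frame `hF : EngineFrame y i ρ_R a₀ τ B x` (E4 part 3, `…FarEngineFrame`) BASED by BBI♯ (E4 part 4 §1,
`EngineFrame.based`): a Hägg word `s`, a linear isometry `g` and a site `p₀ ∈ 𝓛(s)` with INCLUSION `x k = g(p − p₀)` for the inner
sites of coordinate norm `≤ r` and FILLING of `𝓛(s)` up to `‖p − p₀‖ ≤ r − 1` (`r ≥ 25/2`).  Writing `p₀ = barlowPos 1 √(2/3) s k₀ i₀ j₀`,
the BASE CHART is `c := ⟨s(· + k₀), B ∘ g, a₀, a₀ · min {‖B(g p)‖ : p ∈ 𝓛(s(·+k₀)), p ≠ 0, ‖p‖ ≤ 1}⟩` — the recentred word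
(`𝓛(s(·+k₀)) = 𝓛(s) − p₀`, C4 `mem_shift_iff`), the frame's affine map read through `g`, and the attained minimum over the finite
nonempty punctured unit window (a nonzero point of norm `> 1` has norm `≥ √2`, and `(22/25)√2 > 28/25`).  No input chart and no
CORE♯ are needed: the frame's own two-shell data and the filling give `IsChart` directly.

* `exists_admissible_chart` — the lattice side: for a Hägg word, a `3/25`-near-isometry and a scale `a > 0` the minimum is attained
  and the chart is `ChartAdmissible (1/25)` (summability: `summable_lennardJones_chart`, `…AffineBarlowSum`).
* `EngineFrame.base_chart` — the base chart exists: admissible, `𝓛(c.s) = 𝓛(s) − p₀`, `c.a₀ • c.B = a₀ • B ∘ g`, and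
  `|c.nn − nn_i| ≤ τ·nn_i` (lower: the filling partner of the minimiser is a site `≠ i`; upper: the actual nearest neighbour of `i`
  is inner, included, and labelled by a nonzero point of `𝓛(c.s)`).
* `EngineFrame.base_isChart` — such a chart is `IsChart κ ε₁ y i c` whenever `τ ≤ κ ε₁` (inclusion ⇒ clause 2, filling ⇒ clause 3;
  both errors are the frame's closeness `τ·nn_i`, cf. E4 part 4 §2).
-/

namespace Summit.AtomisticToContinuum.Crystallization.Theorems.OverbindingBudgetAffineFarSmoothSplit

open Literature.MathematicalPhysics.StatisticalMechanics
open Literature.Geometry.DiscreteGeometry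
open Summit.AtomisticToContinuum.Crystallization.Theorems.OverbindingBudgetAffineLadder
open Summit.AtomisticToContinuum.Crystallization.Theorems.OverbindingBudgetAffineLocalisation
open scoped Classical

/-! ## §1  The lattice side: the punctured-window minimum is attained and gives an admissible chart -/

/-- **ADMISSIBLE CHART FROM A WORD, A NEAR-ISOMETRY AND A SCALE (PROVED).**  For a Hägg word `t`, a linear `B'` within `3·(1/25)` of a
linear isometry and `a > 0`: some nonzero `p_m ∈ 𝓛(t)` with `‖p_m‖ ≤ 1` minimises `‖B' ·‖` over ALL nonzero points of `𝓛(t)`, and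
`⟨t, B', a, a‖B' p_m‖⟩` is `ChartAdmissible (1/25)`. [this file] -/
theorem exists_admissible_chart {t : ℤ → ℤ} (ht : IsHaggSeq t)
    {B' : EuclideanSpace ℝ (Fin 3) →ₗ[ℝ] EuclideanSpace ℝ (Fin 3)}
    (hB' : ∃ Q : EuclideanSpace ℝ (Fin 3) →ₗᵢ[ℝ] EuclideanSpace ℝ (Fin 3), ∀ v, ‖B' v - Q v‖ ≤ 3 * (1 / 25) * ‖v‖)
    {a : ℝ} (ha : 0 < a) :
    ∃ (pm : EuclideanSpace ℝ (Fin 3)) (nn₀ : ℝ), ChartAdmissible (1 / 25) ⟨t, B', a, nn₀⟩ ∧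
      pm ∈ barlowStacking 1 (Real.sqrt (2 / 3)) t ∧ pm ≠ 0 ∧ ‖pm‖ ≤ 1 ∧ nn₀ = a * ‖B' pm‖ := by
  obtain ⟨hlo, hhi⟩ := near_iso_bounds hB'
  have h72 : (7 / 5 : ℝ) < Real.sqrt 2 := (Real.lt_sqrt (by norm_num)).2 (by norm_num)
  -- a norm-one point of the origin shell: the punctured unit window is nonempty
  have hσ := cast_letter_eq ht 0
  have hτ := neg_cast_letter_eq ht (0 - 1)
  obtain ⟨e, he⟩ := Set.nonempty_of_ncard_ne_zero
    (s := barlowShell (t 0 : ℝ) (-((t (0 - 1) : ℤ) : ℝ))) (by rw [ncard_barlowShell hσ hτ]; norm_num)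
  have he1 : ‖e‖ = 1 := norm_eq_one_of_mem_barlowShell hσ hτ he
  have he0 : e ≠ 0 := fun h => by rw [h, norm_zero] at he1; exact zero_ne_one he1
  -- the finite punctured unit window and the minimiser
  have hmemS : ∀ p, p ∈ (finite_window t 1).toFinset.filter (fun p => p ≠ 0) ↔
      (p ∈ barlowStacking 1 (Real.sqrt (2 / 3)) t ∧ ‖p‖ ≤ 1) ∧ p ≠ 0 := fun p => by
    rw [Finset.mem_filter, Set.Finite.mem_toFinset, Set.mem_setOf_eq, dist_zero_right]
  obtain ⟨pm, hpmS, hmin⟩ := ((finite_window t 1).toFinset.filter (fun p => p ≠ 0)).exists_min_image (fun p => ‖B' p‖)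
    ⟨e, (hmemS e).2 ⟨⟨mem_of_mem_originShell ht he, he1.le⟩, he0⟩⟩
  obtain ⟨⟨hpmX, hpm1⟩, hpm0⟩ := (hmemS pm).1 hpmS
  have hBpm : 0 < ‖B' pm‖ := by
    have h1 := hlo pm
    have h2 := norm_pos_iff.2 hpm0
    linarith
  refine ⟨pm, a * ‖B' pm‖, ⟨ht, ha, mul_pos ha hBpm, hB', ?_, ⟨pm, hpmX, hpm0, rfl⟩,
    summable_lennardJones_chart ht (m := 3 * (1 / 25)) (by norm_num) hB' ha⟩, hpmX, hpm0, hpm1, rfl⟩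
  -- `a‖B' p_m‖` is a lower bound over all nonzero points: the window by minimality, the rest by `‖p‖ ≥ √2`
  intro p hp hp0
  show a * ‖B' pm‖ ≤ a * ‖B' p‖
  refine mul_le_mul_of_nonneg_left ?_ ha.le
  by_cases h1 : ‖p‖ ≤ 1
  · exact hmin p ((hmemS p).2 ⟨⟨hp, h1⟩, hp0⟩)
  · have h2 : Real.sqrt 2 ≤ ‖p‖ := by
      rcases norm_eq_one_or_sqrt_two_le ht hp hp0 with h | h
      · exact absurd h.le h1
      · exact h
    have h3 := hhi pm
    have h4 := hlo p
    linarith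

namespace EngineFrame

variable {N : ℕ} {y : Fin N → EuclideanSpace ℝ (Fin 3)} {i : Fin N} {ρR a₀ τ : ℝ}
  {B : EuclideanSpace ℝ (Fin 3) →ₗ[ℝ] EuclideanSpace ℝ (Fin 3)} {x : Fin N → EuclideanSpace ℝ (Fin 3)}

/-! ## §2  The base chart of a based frame -/

/-- The centre is inner. [this file] -/
theorem centre_inner (hF : EngineFrame y i ρR a₀ τ B x) : dist (y i) (y i) ≤ (ρR - 3) * nearestDist y i := by
  rw [dist_self]; exact mul_nonneg (by linarith [hF.ρR_ge]) hF.nn_pos.le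

/-- **LOWER SCALE BOUND (PROVED)**: if a nonzero `q` with `‖q‖ ≤ r − 1` has `p₀ + q ∈ 𝓛(s)` (so the filling gives it a site), then
`nn_i ≤ a₀‖B(g q)‖ + τ·nn_i`. [this file] -/
theorem nn_le_of_fill (hF : EngineFrame y i ρR a₀ τ B x) {s : ℤ → ℤ}
    (g : EuclideanSpace ℝ (Fin 3) ≃ₗᵢ[ℝ] EuclideanSpace ℝ (Fin 3)) {p₀ : EuclideanSpace ℝ (Fin 3)} {r : ℝ}
    (hfill : ∀ p ∈ barlowStacking 1 (Real.sqrt (2 / 3)) s, ‖p - p₀‖ ≤ r - 1 →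
      ∃ k, dist (y k) (y i) ≤ (ρR - 3) * nearestDist y i ∧ x k = g (p - p₀))
    {q : EuclideanSpace ℝ (Fin 3)} (hq : q + p₀ ∈ barlowStacking 1 (Real.sqrt (2 / 3)) s) (hq0 : q ≠ 0) (hqr : ‖q‖ ≤ r - 1) :
    nearestDist y i ≤ a₀ * ‖B (g q)‖ + τ * nearestDist y i := by
  obtain ⟨k, -, hxk⟩ := hfill (q + p₀) hq (by rw [add_sub_cancel_right]; exact hqr)
  rw [add_sub_cancel_right] at hxk
  have hki : k ≠ i := by
    intro h
    apply hq0
    apply g.injective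
    rw [← hxk, h, hF.x_centre, map_zero]
  have h1 := nearestDist_le_dist y hki
  have h2 := hF.close k
  have h3 : ‖y k - y i‖ ≤ ‖y k - y i - a₀ • B (x k)‖ + ‖a₀ • B (x k)‖ := by
    have := norm_add_le (y k - y i - a₀ • B (x k)) (a₀ • B (x k))
    rwa [sub_add_cancel] at this
  rw [dist_comm, dist_eq_norm] at h1
  rw [hxk] at h2
  rw [hxk, norm_smul, Real.norm_eq_abs, abs_of_pos hF.a₀_pos] at h3
  linarith

/-- **UPPER SCALE BOUND (PROVED)**: if every nonzero `q` with `q + p₀ ∈ 𝓛(s)` has `ν ≤ a₀‖B(g q)‖`, then `ν ≤ nn_i + τ·nn_i`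
(the actual nearest neighbour of `i` is inner, of coordinate norm `≤ 29/25 ≤ r`, hence included and labelled by such a `q`). [this file] -/
theorem le_nn_of_incl (hF : EngineFrame y i ρR a₀ τ B x) {s : ℤ → ℤ}
    (g : EuclideanSpace ℝ (Fin 3) ≃ₗᵢ[ℝ] EuclideanSpace ℝ (Fin 3)) {p₀ : EuclideanSpace ℝ (Fin 3)} {r : ℝ} (hr : 25 / 2 ≤ r)
    (hincl : ∀ k, dist (y k) (y i) ≤ (ρR - 3) * nearestDist y i → ‖x k‖ ≤ r →
      ∃ p ∈ barlowStacking 1 (Real.sqrt (2 / 3)) s, x k = g (p - p₀))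
    {ν : ℝ} (hν : ∀ q : EuclideanSpace ℝ (Fin 3), q + p₀ ∈ barlowStacking 1 (Real.sqrt (2 / 3)) s → q ≠ 0 → ν ≤ a₀ * ‖B (g q)‖) :
    ν ≤ nearestDist y i + τ * nearestDist y i := by
  have hnn := hF.nn_pos
  obtain ⟨k₁, hk₁i, hk₁⟩ := exists_nearestDist_eq_dist y (hF.exists_ne hF.centre_inner)
  rw [dist_comm] at hk₁
  have hk₁J : dist (y k₁) (y i) ≤ (ρR - 3) * nearestDist y i := by
    rw [← hk₁]
    have h := mul_le_mul_of_nonneg_right (show (1 : ℝ) ≤ ρR - 3 by linarith [hF.ρR_ge]) hnn.le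
    linarith
  have hxk₁ : ‖x k₁‖ ≤ r := by
    have h1 := hF.norm_le k₁
    rw [← hk₁] at h1
    have h2 : nearestDist y i * (7 / 8 * ‖x k₁‖) ≤ nearestDist y i * (101 / 100) := by linarith
    have h3 := le_of_mul_le_mul_left h2 hnn
    linarith
  obtain ⟨p, hp, hxp⟩ := hincl k₁ hk₁J hxk₁
  have hp0 : p - p₀ ≠ 0 := by
    intro h0
    refine hk₁i (hF.inj hF.centre_inner ?_)
    rw [hxp, h0, map_zero, hF.x_centre]
  have h1 := hν (p - p₀) (by rw [sub_add_cancel]; exact hp) hp0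
  rw [← hxp] at h1
  have h2 := hF.close k₁
  have h3 : ‖a₀ • B (x k₁)‖ ≤ ‖y k₁ - y i‖ + ‖y k₁ - y i - a₀ • B (x k₁)‖ := by
    have := norm_sub_le (y k₁ - y i) (y k₁ - y i - a₀ • B (x k₁))
    rwa [sub_sub_cancel] at this
  have hk₁' : ‖y k₁ - y i‖ = nearestDist y i := by rw [← dist_eq_norm]; exact hk₁.symm
  rw [norm_smul, Real.norm_eq_abs, abs_of_pos hF.a₀_pos, hk₁'] at h3
  linarith

/-- **THE BASE CHART (PROVED).**  A based frame (`s, g, p₀`, inclusion/filling at `r ≥ 25/2`) has a chart `c` with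
`ChartAdmissible (1/25) c`, `𝓛(c.s) = 𝓛(s) − p₀`, `c.a₀ • c.B = a₀ • B ∘ g`, and `|c.nn − nn_i| ≤ τ·nn_i`. [this file] -/
theorem base_chart (hF : EngineFrame y i ρR a₀ τ B x) {s : ℤ → ℤ} (hs : IsHaggSeq s)
    (g : EuclideanSpace ℝ (Fin 3) ≃ₗᵢ[ℝ] EuclideanSpace ℝ (Fin 3)) {p₀ : EuclideanSpace ℝ (Fin 3)}
    (hp₀ : p₀ ∈ barlowStacking 1 (Real.sqrt (2 / 3)) s) {r : ℝ} (hr : 25 / 2 ≤ r)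
    (hincl : ∀ k, dist (y k) (y i) ≤ (ρR - 3) * nearestDist y i → ‖x k‖ ≤ r →
      ∃ p ∈ barlowStacking 1 (Real.sqrt (2 / 3)) s, x k = g (p - p₀))
    (hfill : ∀ p ∈ barlowStacking 1 (Real.sqrt (2 / 3)) s, ‖p - p₀‖ ≤ r - 1 →
      ∃ k, dist (y k) (y i) ≤ (ρR - 3) * nearestDist y i ∧ x k = g (p - p₀)) :
    ∃ c : Chart, ChartAdmissible (1 / 25) c ∧
      (∀ p : EuclideanSpace ℝ (Fin 3),
        p ∈ barlowStacking 1 (Real.sqrt (2 / 3)) c.s ↔ p + p₀ ∈ barlowStacking 1 (Real.sqrt (2 / 3)) s) ∧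
      (∀ v : EuclideanSpace ℝ (Fin 3), c.a₀ • c.B v = a₀ • B (g v)) ∧
      |c.nn - nearestDist y i| ≤ τ * nearestDist y i := by
  have hnn := hF.nn_pos
  obtain ⟨k₀, i₀, j₀, hp₀eq⟩ := id hp₀
  have hs' : IsHaggSeq (fun n => s (n + k₀)) := fun n => hs (n + k₀)
  obtain ⟨Q₀, hQ₀⟩ := hF.B_near
  have hQ' : ∃ Q' : EuclideanSpace ℝ (Fin 3) →ₗᵢ[ℝ] EuclideanSpace ℝ (Fin 3), ∀ v,
      ‖(B ∘ₗ (g.toLinearEquiv : EuclideanSpace ℝ (Fin 3) →ₗ[ℝ] EuclideanSpace ℝ (Fin 3))) v - Q' v‖ ≤ 3 * (1 / 25) * ‖v‖ :=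
    ⟨Q₀.comp g.toLinearIsometry, fun v => by rw [← g.norm_map v]; exact hQ₀ (g v)⟩
  obtain ⟨pm, nn₀, hadm, hpmX, hpm0, hpm1, hpmeq⟩ := exists_admissible_chart hs' hQ' hF.a₀_pos
  have hiff : ∀ p : EuclideanSpace ℝ (Fin 3), p ∈ barlowStacking 1 (Real.sqrt (2 / 3)) (fun n => s (n + k₀)) ↔
      p + p₀ ∈ barlowStacking 1 (Real.sqrt (2 / 3)) s := fun p => mem_shift_iff hp₀eq p
  refine ⟨⟨fun n => s (n + k₀), B ∘ₗ (g.toLinearEquiv : EuclideanSpace ℝ (Fin 3) →ₗ[ℝ] EuclideanSpace ℝ (Fin 3)), a₀, nn₀⟩,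
    hadm, hiff, fun v => rfl, ?_⟩
  have hmin : ∀ q : EuclideanSpace ℝ (Fin 3), q + p₀ ∈ barlowStacking 1 (Real.sqrt (2 / 3)) s → q ≠ 0 →
      nn₀ ≤ a₀ * ‖B (g q)‖ := fun q hq hq0 => hadm.2.2.2.2.1 q ((hiff q).2 hq) hq0
  have hpmeq' : nn₀ = a₀ * ‖B (g pm)‖ := hpmeq
  show |nn₀ - nearestDist y i| ≤ τ * nearestDist y i
  rw [abs_le]
  constructor
  · have h := hF.nn_le_of_fill g hfill ((hiff pm).1 hpmX) hpm0 (by linarith)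
    linarith
  · have h := hF.le_nn_of_incl g hr hincl hmin
    linarith

/-! ## §3  The base chart is a chart for the configuration -/

/-- **BASE CHART ⇒ `IsChart` (PROVED).**  For a based frame and a chart with `𝓛(c.s) = 𝓛(s) − p₀`, `c.a₀ • c.B = a₀ • B ∘ g`,
`|c.nn − nn_i| ≤ τ·nn_i`, `c.a₀ > 0`: `IsChart κ ε₁ y i c` whenever `τ ≤ κ ε₁` (sites within `9·nn_i` have coordinate norm `≤ 10.3 ≤ r`,
included; structure points with `c.a₀‖c.B p‖ ≤ 9·nn_i` have `‖p‖ ≤ 72/7 ≤ r − 1`, filled). [this file] -/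
theorem base_isChart (hF : EngineFrame y i ρR a₀ τ B x) {s : ℤ → ℤ}
    (g : EuclideanSpace ℝ (Fin 3) ≃ₗᵢ[ℝ] EuclideanSpace ℝ (Fin 3)) {p₀ : EuclideanSpace ℝ (Fin 3)} {r : ℝ} (hr : 25 / 2 ≤ r)
    (hincl : ∀ k, dist (y k) (y i) ≤ (ρR - 3) * nearestDist y i → ‖x k‖ ≤ r →
      ∃ p ∈ barlowStacking 1 (Real.sqrt (2 / 3)) s, x k = g (p - p₀))
    (hfill : ∀ p ∈ barlowStacking 1 (Real.sqrt (2 / 3)) s, ‖p - p₀‖ ≤ r - 1 →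
      ∃ k, dist (y k) (y i) ≤ (ρR - 3) * nearestDist y i ∧ x k = g (p - p₀))
    {c : Chart}
    (hiff : ∀ p : EuclideanSpace ℝ (Fin 3),
      p ∈ barlowStacking 1 (Real.sqrt (2 / 3)) c.s ↔ p + p₀ ∈ barlowStacking 1 (Real.sqrt (2 / 3)) s)
    (hcB : ∀ v : EuclideanSpace ℝ (Fin 3), c.a₀ • c.B v = a₀ • B (g v))
    (hcnn : |c.nn - nearestDist y i| ≤ τ * nearestDist y i) (hca : 0 < c.a₀)
    {κ ε₁ : ℝ} (hτκ : τ ≤ κ * ε₁) : IsChart κ ε₁ y i c := by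
  have hnn := hF.nn_pos
  have hτκ' : τ * nearestDist y i ≤ κ * ε₁ * nearestDist y i := mul_le_mul_of_nonneg_right hτκ hnn.le
  refine ⟨hcnn.trans hτκ', fun k hk9 => ?_, fun p hp hp9 => ?_⟩
  · -- sites of the `9·nn`-ball are inner and included
    have hkJ : dist (y k) (y i) ≤ (ρR - 3) * nearestDist y i :=
      hk9.trans (mul_le_mul_of_nonneg_right (by linarith [hF.ρR_ge]) hnn.le)
    have hxk : ‖x k‖ ≤ r := by
      have h1 := hF.norm_le k
      have h2 : nearestDist y i * (7 / 8 * ‖x k‖) ≤ nearestDist y i * (901 / 100) := by linarith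
      have h3 := le_of_mul_le_mul_left h2 hnn
      linarith
    obtain ⟨p, hp, hxp⟩ := hincl k hkJ hxk
    refine ⟨p - p₀, (hiff _).2 (by rw [sub_add_cancel]; exact hp), ?_⟩
    rw [hcB, ← hxp, dist_eq_norm, sub_add_eq_sub_sub]
    exact (hF.close k).trans hτκ'
  · -- structure points predicted in the `9·nn`-ball are filled
    have hqr : ‖p + p₀ - p₀‖ ≤ r - 1 := by
      rw [add_sub_cancel_right]
      have h1 := hF.le_smul_norm (g p)
      rw [LinearIsometryEquiv.norm_map, ← hcB, norm_smul, Real.norm_eq_abs, abs_of_pos hca] at h1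
      have h2 : nearestDist y i * (7 / 8 * ‖p‖) ≤ nearestDist y i * 9 := by linarith
      have h3 := le_of_mul_le_mul_left h2 hnn
      linarith
    obtain ⟨k, -, hxk⟩ := hfill (p + p₀) ((hiff p).1 hp) hqr
    rw [add_sub_cancel_right] at hxk
    refine ⟨k, ?_⟩
    rw [hcB, ← hxk, dist_eq_norm, sub_add_eq_sub_sub]
    exact (hF.close k).trans hτκ'

end EngineFrame

end Summit.AtomisticToContinuum.Crystallization.Theorems.OverbindingBudgetAffineFarSmoothSplit
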